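import Mathlib
import Summits.NavierStokesRegularity.NavierStokesRegularity.Theorems.BarrierStepRungThreeCertificateProfileAbove
import HarnessLib

/-!
# Profile kit for window certificates in the repaired format K2″ (route `BarrierStepRungThree`),
  part IIb: the slack majorant (clause 14)

Continuation of `BarrierStepRungThreeCertificateProfileAbove.lean` (items
stmt-NavierStokesRegularity-23420 / 23648 / 23942).  With the envelope `env = q²/2` outside the
window and `E_w + q_top²/2` on the window (`q` geometric below with `G² < 8`, doubly exponential
above with `0 < z₀ ≤ 1`), every finite weighted sum `∑_{k' ∈ T} 8^{k'} env_{k'}` is at most the explicit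
number `W = (Q_b²/2) 8^{kLo} 8/(8-G²) + n 8^{K-1}(E_w + q_top²/2) + (4/3) 2^{-2K}/κ²`
(`weighted_env_sum_le`), whence clause 14 of the certificate format with the slack majorant
`Ψ_k = c 2^{-k} W`: `slackWeight 1 θ c env L k ≤ Ψ_k` for all `L` (`slackWeight_le`; uses
`2^{(5/2+θ)d} ≤ 8^d` for `θ ≤ 1/2` and `4^k 8^d = 2^{-k} 8^{k+d}`).

HONEST FRAMING: bookkeeping for certificates about Tao-type MODEL lattice pseudo-flows (rung TL-M3);
it constructs no certificate, proves nothing about any table, and says nothing about the Navier–Stokes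
equations; no summit is proved by this file.
-/

noncomputable section

-- the sub-problem namespace repeats the summit name by design (D-0017)
set_option linter.dupNamespace false

namespace Summit.NavierStokesRegularity.NavierStokesRegularity.Theorems

namespace CertificateProfile

open scoped BigOperators
open Literature.Analysis.FluidPDE Literature.Analysis.FluidPDE.TaoCascade

/-! ### The slack majorant (clause 14) -/

section Slack

variable {Q_b G κ z₀ E_w q_top : ℝ} {kLo K : ℤ} {n : ℕ} {q env : ℤ → ℝ}

/-- **Finite partial sums of the weighted envelope are bounded.** With the envelope `env = q²/2`
outside the window and `E_w + q_top²/2` on the window (`q` the geometric profile below, `G² < 8`, and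
the doubly-exponential profile above), every finite sum `∑_{k' ∈ T} 8^{k'} env_{k'}` is at most
`W = (Q_b²/2) 8^{kLo} · 8/(8-G²) + n · 8^{K-1} (E_w + q_top²/2) + (4/3) 2^{-2K}/κ²`. [folklore] -/
theorem weighted_env_sum_le (hQb : 0 < Q_b) (hG : 0 < G) (hG8 : G ^ 2 < 8) (hκ : 0 < κ)
    (hz : 0 < z₀) (hz1 : z₀ ≤ 1) (hEw : 0 ≤ E_w) (hK : K = kLo + n)
    (hqb : ∀ k, k < kLo → q k = Q_b * G ^ (kLo - k).toNat)
    (hqa : ∀ k, K - 1 ≤ k →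
      q k = z₀ ^ (2 ^ (k - K + 1).toNat) / (κ * (2 : ℝ) ^ ((5 : ℝ) * ((k : ℝ) + 1) / 2)))
    (henvB : ∀ k, k < kLo → env k = q k ^ 2 / 2)
    (henvW : ∀ k, kLo ≤ k → k ≤ K - 1 → env k = E_w + q_top ^ 2 / 2)
    (henvA : ∀ k, K ≤ k → env k = q k ^ 2 / 2) (T : Finset ℤ) :
    ∑ k' ∈ T, (2 : ℝ) ^ ((3 : ℝ) * (k' : ℝ)) * env k' ≤
      Q_b ^ 2 / 2 * (2 : ℝ) ^ ((3 : ℝ) * (kLo : ℝ)) * (8 / (8 - G ^ 2)) +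
        n * (2 : ℝ) ^ ((3 : ℝ) * ((K : ℝ) - 1)) * (E_w + q_top ^ 2 / 2) +
        4 / 3 * (2 : ℝ) ^ (-(2 : ℝ) * (K : ℝ)) / κ ^ 2 := by
  classical
  set f : ℤ → ℝ := fun k' => (2 : ℝ) ^ ((3 : ℝ) * (k' : ℝ)) * env k' with hf
  -- split the index set into the three zones
  set TB := T.filter (fun k' => k' < kLo) with hTB
  set TR := T.filter (fun k' => ¬ k' < kLo) with hTR
  set TW := TR.filter (fun k' => k' ≤ K - 1) with hTW
  set TA := TR.filter (fun k' => ¬ k' ≤ K - 1) with hTA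
  have hsplit : ∑ k' ∈ T, f k' = ∑ k' ∈ TB, f k' + (∑ k' ∈ TW, f k' + ∑ k' ∈ TA, f k') := by
    rw [hTW, hTA, Finset.sum_filter_add_sum_filter_not, hTB, hTR,
      Finset.sum_filter_add_sum_filter_not]
  -- zone B: geometric series with ratio G²/8
  set x : ℝ := G ^ 2 / 8 with hx
  have hx0 : 0 ≤ x := by positivity
  have hx1 : x < 1 := by rw [hx, div_lt_one (by norm_num)]; exact hG8
  have hBterm : ∀ k' ∈ TB, f k' =
      Q_b ^ 2 / 2 * (2 : ℝ) ^ ((3 : ℝ) * (kLo : ℝ)) * x ^ (kLo - k').toNat := by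
    intro k' hk'
    have hk'lo : k' < kLo := (Finset.mem_filter.1 hk').2
    simp only [hf]
    rw [henvB k' hk'lo, hqb k' hk'lo]
    have hcast : ((k' : ℤ) : ℝ) = (kLo : ℝ) - ((kLo - k').toNat : ℝ) := by
      have : ((kLo - k').toNat : ℤ) = kLo - k' := Int.toNat_of_nonneg (by omega)
      have h' : (k' : ℝ) = (kLo : ℝ) - (((kLo - k').toNat : ℤ) : ℝ) := by
        rw [this]; push_cast; ring
      rw [h']; norm_cast
    have e8 : (2 : ℝ) ^ ((3 : ℝ) * (k' : ℝ)) =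
        (2 : ℝ) ^ ((3 : ℝ) * (kLo : ℝ)) * ((2 : ℝ) ^ (-(3 : ℝ))) ^ (kLo - k').toNat := by
      rw [two_rpow_pow, ← two_rpow_add, hcast]; congr 1; ring
    have e18 : (2 : ℝ) ^ (-(3 : ℝ)) = 1 / 8 := by
      rw [Real.rpow_neg (by norm_num)]; norm_num
    rw [e8, e18]
    have h8 : (G ^ 2 / 8) ^ (kLo - k').toNat = (G ^ (kLo - k').toNat) ^ 2 / 8 ^ (kLo - k').toNat := by
      rw [div_pow, ← pow_mul, ← pow_mul, mul_comm]
    rw [hx, h8, one_div_pow]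
    have h8pos : (0 : ℝ) < 8 ^ (kLo - k').toNat := by positivity
    field_simp
  have hB : ∑ k' ∈ TB, f k' ≤ Q_b ^ 2 / 2 * (2 : ℝ) ^ ((3 : ℝ) * (kLo : ℝ)) * (8 / (8 - G ^ 2)) := by
    rw [Finset.sum_congr rfl hBterm, ← Finset.mul_sum]
    have hgeom : ∑ k' ∈ TB, x ^ (kLo - k').toNat ≤ 8 / (8 - G ^ 2) := by
      have hinj : ∀ a ∈ TB, ∀ b ∈ TB, (kLo - a).toNat = (kLo - b).toNat → a = b := by
        intro a ha b hb hab
        have := (Finset.mem_filter.1 ha).2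
        have := (Finset.mem_filter.1 hb).2
        omega
      rw [← Finset.sum_image hinj]
      have hs := summable_geometric_of_lt_one hx0 hx1
      calc ∑ j ∈ TB.image (fun a => (kLo - a).toNat), x ^ j
          ≤ ∑' j : ℕ, x ^ j := hs.sum_le_tsum _ (fun j _ => pow_nonneg hx0 j)
        _ = (1 - x)⁻¹ := tsum_geometric_of_lt_one hx0 hx1
        _ = 8 / (8 - G ^ 2) := by
            rw [hx]
            have : (8 : ℝ) - G ^ 2 ≠ 0 := by linarith
            rw [one_sub_div (by norm_num : (8 : ℝ) ≠ 0), inv_div]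
    exact mul_le_mul_of_nonneg_left hgeom (by positivity)
  -- zone W: at most n terms, each at most 8^{K-1} (E_w + q_top²/2)
  have hW : ∑ k' ∈ TW, f k' ≤ n * (2 : ℝ) ^ ((3 : ℝ) * ((K : ℝ) - 1)) * (E_w + q_top ^ 2 / 2) := by
    have hterm : ∀ k' ∈ TW, f k' ≤ (2 : ℝ) ^ ((3 : ℝ) * ((K : ℝ) - 1)) * (E_w + q_top ^ 2 / 2) := by
      intro k' hk'
      have h1 : ¬ k' < kLo := (Finset.mem_filter.1 (Finset.mem_filter.1 hk').1).2
      have h2 : k' ≤ K - 1 := (Finset.mem_filter.1 hk').2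
      simp only [hf]
      rw [henvW k' (by omega) h2]
      refine mul_le_mul_of_nonneg_right ?_ (by positivity)
      refine Real.rpow_le_rpow_of_exponent_le (by norm_num) ?_
      have : (k' : ℝ) ≤ (K : ℝ) - 1 := by
        have : ((k' : ℤ) : ℝ) ≤ ((K - 1 : ℤ) : ℝ) := by exact_mod_cast h2
        push_cast at this; exact this
      linarith
    have hcard : TW.card ≤ n := by
      have hsub : TW ⊆ Finset.Icc kLo (K - 1) := by
        intro k' hk'
        have h1 : ¬ k' < kLo := (Finset.mem_filter.1 (Finset.mem_filter.1 hk').1).2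
        have h2 : k' ≤ K - 1 := (Finset.mem_filter.1 hk').2
        exact Finset.mem_Icc.2 ⟨by omega, h2⟩
      calc TW.card ≤ (Finset.Icc kLo (K - 1)).card := Finset.card_le_card hsub
        _ = n := by rw [Int.card_Icc]; omega
    have hpos : 0 ≤ (2 : ℝ) ^ ((3 : ℝ) * ((K : ℝ) - 1)) * (E_w + q_top ^ 2 / 2) := by positivity
    calc ∑ k' ∈ TW, f k' ≤ TW.card • ((2 : ℝ) ^ ((3 : ℝ) * ((K : ℝ) - 1)) * (E_w + q_top ^ 2 / 2)) :=
          Finset.sum_le_card_nsmul _ _ _ hterm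
      _ = (TW.card : ℝ) * ((2 : ℝ) ^ ((3 : ℝ) * ((K : ℝ) - 1)) * (E_w + q_top ^ 2 / 2)) := by
          rw [nsmul_eq_mul]
      _ ≤ (n : ℝ) * ((2 : ℝ) ^ ((3 : ℝ) * ((K : ℝ) - 1)) * (E_w + q_top ^ 2 / 2)) :=
          mul_le_mul_of_nonneg_right (by exact_mod_cast hcard) hpos
      _ = _ := by ring
  -- zone A: geometric series with ratio 1/4 from the doubly-exponential profile
  have hAterm : ∀ k' ∈ TA, f k' ≤ (2 : ℝ) ^ (-(2 : ℝ) * (K : ℝ)) / κ ^ 2 * (1 / 4 : ℝ) ^ (k' - K).toNat := by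
    intro k' hk'
    have h2 : ¬ k' ≤ K - 1 := (Finset.mem_filter.1 hk').2
    have hk'K : K ≤ k' := by omega
    simp only [hf]
    rw [henvA k' hk'K]
    refine (above_sq_weight_le hκ hz hz1 hqa (by omega)).trans (le_of_eq ?_)
    have hcast : ((k' : ℤ) : ℝ) = (K : ℝ) + ((k' - K).toNat : ℝ) := by
      have : ((k' - K).toNat : ℤ) = k' - K := Int.toNat_of_nonneg (by omega)
      have h' : (k' : ℝ) = (K : ℝ) + (((k' - K).toNat : ℤ) : ℝ) := by
        rw [this]; push_cast; ring
      rw [h']; norm_cast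
    have e4 : (2 : ℝ) ^ (-(2 : ℝ) * (k' : ℝ)) =
        (2 : ℝ) ^ (-(2 : ℝ) * (K : ℝ)) * ((2 : ℝ) ^ (-(2 : ℝ))) ^ (k' - K).toNat := by
      rw [two_rpow_pow, ← two_rpow_add, hcast]; congr 1; ring
    have e14 : (2 : ℝ) ^ (-(2 : ℝ)) = 1 / 4 := by
      rw [Real.rpow_neg (by norm_num)]; norm_num
    rw [e4, e14]
    ring
  have hA : ∑ k' ∈ TA, f k' ≤ 4 / 3 * (2 : ℝ) ^ (-(2 : ℝ) * (K : ℝ)) / κ ^ 2 := by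
    refine (Finset.sum_le_sum hAterm).trans ?_
    rw [← Finset.mul_sum]
    have hgeom : ∑ k' ∈ TA, (1 / 4 : ℝ) ^ (k' - K).toNat ≤ 4 / 3 := by
      have hinj : ∀ a ∈ TA, ∀ b ∈ TA, (a - K).toNat = (b - K).toNat → a = b := by
        intro a ha b hb hab
        have := (Finset.mem_filter.1 ha).2
        have := (Finset.mem_filter.1 hb).2
        omega
      rw [← Finset.sum_image hinj]
      have h40 : (0 : ℝ) ≤ 1 / 4 := by norm_num
      have h41 : (1 / 4 : ℝ) < 1 := by norm_num
      have hs := summable_geometric_of_lt_one h40 h41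
      calc ∑ j ∈ TA.image (fun a => (a - K).toNat), (1 / 4 : ℝ) ^ j
          ≤ ∑' j : ℕ, (1 / 4 : ℝ) ^ j := hs.sum_le_tsum _ (fun j _ => pow_nonneg h40 j)
        _ = (1 - 1 / 4)⁻¹ := tsum_geometric_of_lt_one h40 h41
        _ = 4 / 3 := by norm_num
    have hpos : 0 ≤ (2 : ℝ) ^ (-(2 : ℝ) * (K : ℝ)) / κ ^ 2 := by positivity
    calc (2 : ℝ) ^ (-(2 : ℝ) * (K : ℝ)) / κ ^ 2 * ∑ k' ∈ TA, (1 / 4 : ℝ) ^ (k' - K).toNat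
        ≤ (2 : ℝ) ^ (-(2 : ℝ) * (K : ℝ)) / κ ^ 2 * (4 / 3) := mul_le_mul_of_nonneg_left hgeom hpos
      _ = _ := by ring
  have htot : ∑ k' ∈ T, f k' ≤ _ := hsplit ▸ add_le_add hB (add_le_add hW hA)
  simpa only [hf, add_assoc] using htot

/-- **Clause 14: the slack majorant.** With `Ψ_k = c · 2^{-k} · W` one has
`slackWeight 1 θ c env L k ≤ Ψ_k` for every number `L` of past epochs and every shell `k`
(`θ ≤ 1/2`, so `2^{(5/2+θ)d} ≤ 8^d`, and `4^k 8^d = 2^{-k} 8^{k+d}`).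
[cite: Tao2016AveragedNS, §6.4 Lemma 6.7 (the cumulative energy bound behind `slackWeight`)] -/
theorem slackWeight_le {θ c : ℝ} (hθ : θ ≤ 1 / 2) (hc : 0 < c)
    (hQb : 0 < Q_b) (hG : 0 < G) (hG8 : G ^ 2 < 8) (hκ : 0 < κ)
    (hz : 0 < z₀) (hz1 : z₀ ≤ 1) (hEw : 0 ≤ E_w) (hK : K = kLo + n)
    (hqb : ∀ k, k < kLo → q k = Q_b * G ^ (kLo - k).toNat)
    (hqa : ∀ k, K - 1 ≤ k →
      q k = z₀ ^ (2 ^ (k - K + 1).toNat) / (κ * (2 : ℝ) ^ ((5 : ℝ) * ((k : ℝ) + 1) / 2)))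
    (henvB : ∀ k, k < kLo → env k = q k ^ 2 / 2)
    (henvW : ∀ k, kLo ≤ k → k ≤ K - 1 → env k = E_w + q_top ^ 2 / 2)
    (henvA : ∀ k, K ≤ k → env k = q k ^ 2 / 2) (L : ℕ) (k : ℤ) :
    slackWeight 1 θ c env L k ≤
      c * (2 : ℝ) ^ (-(k : ℝ)) *
        (Q_b ^ 2 / 2 * (2 : ℝ) ^ ((3 : ℝ) * (kLo : ℝ)) * (8 / (8 - G ^ 2)) +
          n * (2 : ℝ) ^ ((3 : ℝ) * ((K : ℝ) - 1)) * (E_w + q_top ^ 2 / 2) +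
          4 / 3 * (2 : ℝ) ^ (-(2 : ℝ) * (K : ℝ)) / κ ^ 2) := by
  classical
  unfold slackWeight
  rw [show (1 + 1 : ℝ) = 2 by norm_num]
  -- the envelope is nonnegative
  have henv0 : ∀ k', 0 ≤ env k' := by
    intro k'
    rcases lt_or_ge k' kLo with h1 | h1
    · rw [henvB k' h1]; positivity
    rcases le_or_gt k' (K - 1) with h2 | h2
    · rw [henvW k' h1 h2]; positivity
    · rw [henvA k' (by omega)]; positivity
  -- termwise: 2^{2k} 2^{(5/2+θ)d} env(k+d) ≤ 2^{-k} (2^{3(k+d)} env(k+d))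
  have hterm : ∀ d ∈ Finset.Icc 1 L,
      (2 : ℝ) ^ ((2 : ℝ) * (k : ℝ)) * ((2 : ℝ) ^ ((5 / 2 + θ) * (d : ℝ)) * env (k + d)) ≤
        (2 : ℝ) ^ (-(k : ℝ)) * ((2 : ℝ) ^ ((3 : ℝ) * (((k + d : ℤ)) : ℝ)) * env (k + d)) := by
    intro d hd
    have hd0 : (0 : ℝ) ≤ d := by positivity
    have hexp : (5 / 2 + θ) * (d : ℝ) ≤ 3 * (d : ℝ) := by nlinarith
    have h1 : (2 : ℝ) ^ ((5 / 2 + θ) * (d : ℝ)) ≤ (2 : ℝ) ^ ((3 : ℝ) * (d : ℝ)) :=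
      Real.rpow_le_rpow_of_exponent_le (by norm_num) hexp
    have h2 : (2 : ℝ) ^ ((2 : ℝ) * (k : ℝ)) * (2 : ℝ) ^ ((3 : ℝ) * (d : ℝ)) =
        (2 : ℝ) ^ (-(k : ℝ)) * (2 : ℝ) ^ ((3 : ℝ) * (((k + d : ℤ)) : ℝ)) := by
      rw [← two_rpow_add, ← two_rpow_add]; congr 1; push_cast; ring
    have hw : 0 ≤ (2 : ℝ) ^ ((2 : ℝ) * (k : ℝ)) := (Real.rpow_pos_of_pos (by norm_num) _).le
    calc (2 : ℝ) ^ ((2 : ℝ) * (k : ℝ)) * ((2 : ℝ) ^ ((5 / 2 + θ) * (d : ℝ)) * env (k + d))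
        ≤ (2 : ℝ) ^ ((2 : ℝ) * (k : ℝ)) * ((2 : ℝ) ^ ((3 : ℝ) * (d : ℝ)) * env (k + d)) :=
          mul_le_mul_of_nonneg_left (mul_le_mul_of_nonneg_right h1 (henv0 _)) hw
      _ = (2 : ℝ) ^ (-(k : ℝ)) * ((2 : ℝ) ^ ((3 : ℝ) * (((k + d : ℤ)) : ℝ)) * env (k + d)) := by
          rw [← mul_assoc, h2, mul_assoc]
  have hsum : (2 : ℝ) ^ ((2 : ℝ) * (k : ℝ)) *
      ∑ d ∈ Finset.Icc 1 L, (2 : ℝ) ^ ((5 / 2 + θ) * (d : ℝ)) * env (k + d) ≤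
      (2 : ℝ) ^ (-(k : ℝ)) *
        ∑ d ∈ Finset.Icc 1 L, (2 : ℝ) ^ ((3 : ℝ) * (((k + d : ℤ)) : ℝ)) * env (k + d) := by
    rw [Finset.mul_sum, Finset.mul_sum]
    exact Finset.sum_le_sum hterm
  -- reindex d ↦ k + d and apply the finite-sum bound
  have hre : ∑ d ∈ Finset.Icc 1 L, (2 : ℝ) ^ ((3 : ℝ) * (((k + d : ℤ)) : ℝ)) * env (k + d) =
      ∑ k' ∈ (Finset.Icc 1 L).image (fun d : ℕ => k + (d : ℤ)),
        (2 : ℝ) ^ ((3 : ℝ) * (k' : ℝ)) * env k' := by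
    rw [Finset.sum_image]
    intro a _ b _ hab
    have hab' : k + (a : ℤ) = k + (b : ℤ) := hab
    have : (a : ℤ) = b := by omega
    exact_mod_cast this
  have hfin := weighted_env_sum_le hQb hG hG8 hκ hz hz1 hEw hK hqb hqa henvB henvW henvA
    ((Finset.Icc 1 L).image (fun d : ℕ => k + (d : ℤ)))
  rw [← hre] at hfin
  have hck : 0 ≤ c * (2 : ℝ) ^ (-(k : ℝ)) := (mul_pos hc (Real.rpow_pos_of_pos (by norm_num) _)).le
  calc c * (2 : ℝ) ^ ((2 : ℝ) * (k : ℝ)) *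
        ∑ d ∈ Finset.Icc 1 L, (2 : ℝ) ^ ((5 / 2 + θ) * (d : ℝ)) * env (k + d)
      = c * ((2 : ℝ) ^ ((2 : ℝ) * (k : ℝ)) *
          ∑ d ∈ Finset.Icc 1 L, (2 : ℝ) ^ ((5 / 2 + θ) * (d : ℝ)) * env (k + d)) := by ring
    _ ≤ c * ((2 : ℝ) ^ (-(k : ℝ)) *
          ∑ d ∈ Finset.Icc 1 L, (2 : ℝ) ^ ((3 : ℝ) * (((k + d : ℤ)) : ℝ)) * env (k + d)) :=
        mul_le_mul_of_nonneg_left hsum hc.le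
    _ = c * (2 : ℝ) ^ (-(k : ℝ)) *
          ∑ d ∈ Finset.Icc 1 L, (2 : ℝ) ^ ((3 : ℝ) * (((k + d : ℤ)) : ℝ)) * env (k + d) := by ring
    _ ≤ _ := mul_le_mul_of_nonneg_left hfin hck

end Slack

end CertificateProfile

end Summit.NavierStokesRegularity.NavierStokesRegularity.Theorems

end
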